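import Summits.ResolutionOfSingularities.ResolutionOfSingularities.Theorems.FrobeniusClosingPatchingRelPerfectDepthPhaseCLocalGameCentres
import Summits.ResolutionOfSingularities.ResolutionOfSingularities.Theorems.FrobeniusClosingPatchingRelPerfectDepthPhaseCLocalGamePatchReductionEnd
import Literature.AlgebraicGeometry.Resolution.DivisorialPart
import Literature.AlgebraicGeometry.Resolution.StrictNormalCrossingsLabels
import Literature.AlgebraicGeometry.Resolution.MonomialOrderReduction
import Literature.AlgebraicGeometry.Resolution.MonomialOrderReductionCanonicalComap
import Literature.AlgebraicGeometry.Resolution.NormalCrossingsBlowupStepReduction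
import HarnessLib

/-!
# Crux `PatchingRelPerfect` (stmt-ResolutionOfSingularities-16161), chain W5.2 — F7(β) (β-AX) X3 C-I (G2) engine, (G-T) monomial case:
# a locally-principal locally-END ideal is a GLOBAL marked monomial ideal on the snc boundary of its prime divisors

[OURS · L1 W5.2 · (G-T) `X3LemmaM.EndOrderReduction`, Bierstone–Milman 2006 §8 Step 2(b) «monomial case», res-L1-w52-lead-1 RECORD R13-1 (3)
→ res-D-pv-001 (second hand under res-D-pv-046); line `Cruxes/PatchingRelPerfect/Lines/closed_point_slice.lean`.]  Replaces the role of NO printed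
item; NOT a statement of the manuscript under review; fact-free; def-free.  AI-written; AI review is weaker than expert review.

THE POINT.  A locally-END ideal `K` (local monomial presentations with snc letters, `X3LemmaM.IsEndNear`) whose local presentations have
ONE row is locally principal, and on a regular integral Noetherian `X` it is then its own DIVISORIAL PART `∏_ζ 𝓘_{cl ζ}^{ord_ζ K}` over the
codimension-one points `ζ` of `cosupp K` (Cossart–Piltant 2008 Prop. 4.2, tree `DivisorialPart.lean`).  The new fact proved here is that these
prime divisors form a GLOBAL simple-normal-crossings boundary:
* `exists_letter_stalkIdeal_eq` — at a point `y` of a single-row presentation (`K = monomialIdeal A`, `boundaryOf A` snc), a codimension-one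
  point `ζ ⤳ y` of `cosupp K` lies on some letter `G` of `A`, and `G_y = (𝓘_{cl ζ})_y` (the letter's stalk is a non-zero principal prime inside
  the height-one prime of `ζ`) — so `(𝓘_{cl ζ})_y` is generated by a regular parameter of the presentation's system;
  `idealOrder_monomialIdeal_eq_weightAt` — `ord_ζ K` is the weight of the row at `ζ`;
* `hasSNC_divisorial_of_singleRow` — **the prime divisors of `cosupp K` have simple normal crossings** (pointwise labelled rsop data pulled
  back from the presentation opens, `hasSNC_of_isRsopPart_labels`);
* `eq_divisorialPart_of_singleRow` / `eq_monomialIdeal_divisorial_of_singleRow` — **`K = ∏_ζ 𝓘_{cl ζ}^{ord_ζ K} = monomialIdeal [(𝓘_{cl ζ}, ord_ζ K)]_ζ`**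
  (`K` is effective Cartier ⇒ locally principal ⇒ `codimTwoPart K = ⊤` ⇒ `K = divisorialPart K`);
* `exists_hasSNC_monomialIdeal_of_singleRow` — the package (with `(boundaryOf E).Nodup`); `exists_isResolutionOf_of_singleRow` — hence
  Kollár's Step 3 (`exists_isResolutionOf_monomialMarked`) resolves `(K, m)` on ALL of `X` at once; and, in the X3 currency of record,
  **`endOrderReduction_of_singleRow`** — the conclusion of `X3LemmaM.EndOrderReduction m` for `K` (res-D-pv-046's one-presentation theorem
  `endOrderReduction_of_presentation` applied to the GLOBAL presentation): the monomial case of (G-T) needs no patching.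

## References (for the mathematics; nothing here is a statement of the manuscript under review)
* E. Bierstone, P. Milman, *Desingularization of toric and binomial varieties*, J. Alg. Geom. 15 (2006), §8 Thm. 8.5 Step 2(b). [BierstoneMilman2006]
* V. Cossart, O. Piltant, J. Algebra 320 (2008), proof of Prop. 4.2 (divisorial part). [CossartPiltant2008]
* J. Kollár, *Lectures on Resolution of Singularities* (2007), (3.111) Step 3. [Kollar2007]
-/

-- `Summit.<Summit>.<Sub>.Theorems` with `Sub = Summit` (single-conjunct summit, D-0017)
set_option linter.dupNamespace false

noncomputable section

open CategoryTheory AlgebraicGeometry TopologicalSpace IsLocalRing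
open Literature.AlgebraicGeometry.Resolution
open Scheme.IdealSheafData

namespace Summit.ResolutionOfSingularities.ResolutionOfSingularities.Theorems

namespace X3LemmaM

universe u

variable {X : Scheme.{u}}

/-! ## §1 Bookkeeping along an open immersion -/

/-- The stalk of `K` at `j y` is the pull-back of the stalk of `K|_W` at `y` along the stalk isomorphism of the open immersion `j`.
[folklore] -/
theorem stalkIdeal_eq_comap_stalkIdeal_comap {W : Scheme.{u}} (j : W ⟶ X) [IsOpenImmersion j] (K : X.IdealSheafData) (y : W) :
    stalkIdeal K (j y) = (stalkIdeal (K.comap j) y).comap (j.stalkMap y).hom := by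
  rw [stalkIdeal_comap_of_isOpenImmersion, Ideal.comap_map_of_bijective _ (ConcreteCategory.bijective_of_isIso (j.stalkMap y))]

/-- **The prime divisor of `j ζ₀` pulls back to the prime divisor of `ζ₀`** along an open immersion `j`. [folklore] -/
theorem comap_primeDivisorIdeal_of_isOpenImmersion {W : Scheme.{u}} (j : W ⟶ X) [IsOpenImmersion j] (ζ₀ : W) :
    (primeDivisorIdeal (j ζ₀)).comap j = primeDivisorIdeal ζ₀ := by
  rw [primeDivisorIdeal, comap_vanishingIdeal_of_isOpenImmersion, primeDivisorIdeal]
  congr 1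
  apply Closeds.ext
  change j ⁻¹' closure {j ζ₀} = closure {ζ₀}
  rw [j.isOpenEmbedding.isOpenMap.preimage_closure_eq_closure_preimage j.continuous, ← Set.image_singleton,
    j.isOpenEmbedding.injective.preimage_image]

/-- A generization and its prime determine each other: `𝔭_ζ = 𝔭_{ζ'}` at a common specialisation forces `ζ = ζ'`. [folklore] -/
theorem eq_of_primeOfSpecializes_eq {ζ ζ' x : X} (h : ζ ⤳ x) (h' : ζ' ⤳ x) (he : primeOfSpecializes h = primeOfSpecializes h') :
    ζ = ζ' := by
  have key : ∀ {a b : X} (ha : a ⤳ x) (hb : b ⤳ x), primeOfSpecializes ha ≤ primeOfSpecializes hb → a ⤳ b := by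
    intro a b ha hb hle
    have hb' : b ∈ (primeDivisorIdeal a).support :=
      (mem_support_iff_stalkIdeal_le_primeOfSpecializes hb (primeDivisorIdeal a)).mpr (by rwa [stalkIdeal_primeDivisorIdeal ha])
    exact (mem_support_primeDivisorIdeal_iff a b).mp hb'
  exact ((key h h' he.le).antisymm (key h' h he.ge)).eq

/-! ## §2 One single-row presentation: the letter through a codimension-one point -/

section Presentation

variable {W : Scheme.{u}} (A : List (W.IdealSheafData × ℕ)) (hA : HasSNC (boundaryOf A))

include hA in
/-- **The letter through a codimension-one point.**  For a single-row presentation `monomialIdeal A` with snc letters, a codimension-one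
point `ζ ⤳ y` of its cosupport lies on some letter `G` of `A`, and the stalk of `G` at `y` IS the prime of the generization `ζ`
(`= (𝓘_{cl ζ})_y`): `G_y` is a non-zero principal prime contained in the height-one prime `𝔭_ζ`. [cite: Kollar2007, (3.111) Step 3] -/
theorem exists_letter_stalkIdeal_eq {ζ y : W} (h : ζ ⤳ y) (hζ1 : Order.coheight ζ = 1)
    (hζ : ζ ∈ (monomialIdeal A).support) :
    ∃ p ∈ A, ζ ∈ p.1.support ∧ y ∈ p.1.support ∧ stalkIdeal p.1 y = stalkIdeal (primeDivisorIdeal ζ) y := by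
  -- a letter through `ζ`
  have hζ' : ζ ∈ (monomialMarked A 1).support := by
    rw [MarkedIdeal.support_of_mult_eq_one _ rfl]; exact hζ
  obtain ⟨p, hp, hζp⟩ := exists_mem_support_of_mem_support_monomialMarked hA le_rfl hζ'
  have hyp : y ∈ p.1.support := h.mem_closed p.1.support.isClosed hζp
  refine ⟨p, hp, hζp, hyp, ?_⟩
  -- the stalk of the letter at `y`: a non-zero principal prime `𝔮 ⊆ 𝔭_ζ`
  obtain ⟨hreg, -⟩ := hA y
  haveI := hreg
  haveI : IsDomain (W.presheaf.stalk y) := isDomain_of_isRegularLocalRing _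
  obtain ⟨f, -, hf2, hf⟩ := hA.exists_generator_of_mem (fst_mem_boundaryOf hp) hyp
  haveI hprime : (stalkIdeal p.1 y).IsPrime := hA.isPrime_stalkIdeal (fst_mem_boundaryOf hp) hyp
  have hne : stalkIdeal p.1 y ≠ ⊥ := by
    rw [hf, Ne, Ideal.span_singleton_eq_bot]
    rintro rfl
    exact hf2 (Ideal.zero_mem _)
  have hle : stalkIdeal p.1 y ≤ primeOfSpecializes h := (mem_support_iff_stalkIdeal_le_primeOfSpecializes h p.1).mp hζp
  have hht : (primeOfSpecializes h).height = 1 := height_primeOfSpecializes_eq_one h hζ1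
  rw [stalkIdeal_primeDivisorIdeal h]
  by_contra hneq
  have hlt : stalkIdeal p.1 y < primeOfSpecializes h := lt_of_le_of_ne hle hneq
  have h0 := Ideal.height_strict_mono_of_isPrime_of_isPrime hlt
  rw [hht, Order.lt_one_iff, Ideal.height_eq_zero_iff_eq_bot] at h0
  exact hne h0

include hA in
/-- **`ord_x (monomialIdeal A) = weightAt A x`** (the order of a monomial in snc letters is the sum of the exponents of the letters
through the point). [cite: BierstoneGrigorievMilmanWlodarczyk2011, §4 Step 2b] -/
theorem idealOrder_monomialIdeal_eq_weightAt (x : W) : idealOrder (monomialIdeal A) x = weightAt A x :=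
  ENat.eq_of_forall_natCast_le_iff fun n => by
    rw [le_idealOrder_monomialIdeal_iff hA n x, Nat.cast_le]

end Presentation

/-! ## §3 A locally single-row END ideal is a global marked monomial ideal with snc boundary -/

section SingleRow

variable [IsIntegral X] [IsNoetherian X] (hX : Scheme.IsRegular X) (K : X.IdealSheafData)
  (hrow : ∀ x ∈ (K.support : Set X), ∃ (U : X.Opens) (A : List (X.IdealSheafData × ℕ)),
    x ∈ (U : Set X) ∧ HasSNC ((boundaryOf A).map fun F => F.comap U.ι) ∧ K.comap U.ι = (monomialIdeal A).comap U.ι)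

omit [IsIntegral X] [AlgebraicGeometry.IsNoetherian X] in
/-- Restricting a single-row presentation to its open: `K|_U = monomialIdeal (A|_U)` with `boundaryOf (A|_U)` snc. [folklore] -/
theorem presentation_comapExp {U : X.Opens} {A : List (X.IdealSheafData × ℕ)}
    (hsnc : HasSNC ((boundaryOf A).map fun F => F.comap U.ι)) (hK : K.comap U.ι = (monomialIdeal A).comap U.ι) :
    HasSNC (boundaryOf (comapExp A U.ι)) ∧ K.comap U.ι = monomialIdeal (comapExp A U.ι) := by
  rw [boundaryOf_comapExp, monomialIdeal_comapExp]
  exact ⟨hsnc, hK⟩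

include hrow in
/-- **A locally single-row END ideal is an effective Cartier divisor** (its stalks are generated by one non-zero monomial).
[cite: Kollar2007, (3.111) Step 3] -/
theorem isEffectiveCartier_of_singleRow : IsEffectiveCartier K := by
  refine isEffectiveCartier_of_stalkIdeal_eq_span_singleton fun x hx => ?_
  obtain ⟨U, A, hxU, hsnc, hK⟩ := hrow x hx
  obtain ⟨hA₀, hK₀⟩ := presentation_comapExp K hsnc hK
  set x₀ : (U : Scheme.{u}) := ⟨x, hxU⟩ with hx₀
  obtain ⟨hreg, -⟩ := hA₀ x₀
  haveI := hreg
  obtain ⟨g, hg, -, hgnot⟩ := exists_generator_stalkIdeal_monomialIdeal (comapExp A U.ι) (x := x₀)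
    fun p hp hxp => hA₀.exists_generator_of_mem (fst_mem_boundaryOf hp) hxp
  have hg0 : g ≠ 0 := by
    rintro rfl
    exact hgnot (Ideal.zero_mem _)
  let φ : X.presheaf.stalk x ≃+* (U : Scheme.{u}).presheaf.stalk x₀ := (asIso (U.ι.stalkMap x₀)).commRingCatIsoToRingEquiv
  refine ⟨φ.symm g, by simpa using hg0, ?_⟩
  have h1 : stalkIdeal K x = (stalkIdeal (K.comap U.ι) x₀).comap (φ : X.presheaf.stalk x →+* _) :=
    stalkIdeal_eq_comap_stalkIdeal_comap U.ι K x₀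
  rw [h1, hK₀, hg]
  change Ideal.comap φ (Ideal.span {g}) = _
  rw [← Ideal.map_symm, Ideal.map_span, Set.image_singleton]

include hrow in
omit [AlgebraicGeometry.IsNoetherian X] in
/-- A locally single-row END ideal on an integral scheme is non-zero. [folklore] -/
theorem ne_bot_of_singleRow : K ≠ ⊥ := by
  intro hKbot
  have hx : genericPoint X ∈ (K.support : Set X) := by
    rw [hKbot, Scheme.IdealSheafData.support_bot]; trivial
  obtain ⟨U, A, hxU, hsnc, hK⟩ := hrow _ hx
  obtain ⟨hA₀, hK₀⟩ := presentation_comapExp K hsnc hK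
  set x₀ : (U : Scheme.{u}) := ⟨genericPoint X, hxU⟩ with hx₀
  obtain ⟨hreg, -⟩ := hA₀ x₀
  haveI := hreg
  obtain ⟨g, hg, -, hgnot⟩ := exists_generator_stalkIdeal_monomialIdeal (comapExp A U.ι) (x := x₀)
    fun p hp hxp => hA₀.exists_generator_of_mem (fst_mem_boundaryOf hp) hxp
  have hg0 : g ≠ 0 := by
    rintro rfl
    exact hgnot (Ideal.zero_mem _)
  rw [hKbot, Scheme.IdealSheafData.comap_bot] at hK₀
  have : stalkIdeal (⊥ : (U : Scheme.{u}).IdealSheafData) x₀ = Ideal.span {g} := by rw [hK₀, hg]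
  rw [stalkIdeal_bot, eq_comm, Ideal.span_singleton_eq_bot] at this
  exact hg0 this

include hX hrow in
/-- **`K = divisorialPart K`**: a locally single-row END ideal on a regular integral Noetherian scheme is its own divisorial part
`∏_ζ 𝓘_{cl ζ}^{ord_ζ K}` (it is locally principal, so its codimension-two part is `𝒪_X`). [cite: CossartPiltant2008, proof of Prop. 4.2] -/
theorem eq_divisorialPart_of_singleRow : K = divisorialPart K := by
  have hK := ne_bot_of_singleRow K hrow
  have hlp : IsLocallyPrincipal K := (isEffectiveCartier_of_singleRow K hrow).isLocallyPrincipal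
  have htop : codimTwoPart K = ⊤ := (isLocallyPrincipal_iff_codimTwoPart_eq_top hX hK).mp hlp
  have h := divisorialPart_mul_codimTwoPart hX hK
  rw [htop, Scheme.IdealSheafData.mul_top] at h
  exact h.symm

include hX hrow in
open scoped Classical in
/-- **`K = monomialIdeal [(𝓘_{cl ζ}, ord_ζ K)]_ζ`** over the (finitely many) codimension-one points `ζ` of `cosupp K`.
[cite: CossartPiltant2008, proof of Prop. 4.2] -/
theorem eq_monomialIdeal_divisorial_of_singleRow :
    K = monomialIdeal ((finite_divisorialPoints (ne_bot_of_singleRow K hrow)).toFinset.toList.map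
      fun ζ => (primeDivisorIdeal ζ, (idealOrder K ζ).toNat)) := by
  conv_lhs => rw [eq_divisorialPart_of_singleRow hX K hrow, divisorialPart_eq (finite_divisorialPoints (ne_bot_of_singleRow K hrow))]
  rw [monomialIdeal, List.map_map, ← Finset.prod_map_toList]
  rfl

include hX hrow in
open scoped Classical in
/-- **The prime divisors of the cosupport of a locally single-row END ideal have simple normal crossings** (globally).  At a point `x` of a
presentation open `U`: the labelled regular parameters of the presentation at `x`, pulled back along `𝒪_{X,x} ≅ 𝒪_{U,x}`; the prime divisor
`cl ζ ∋ x` is labelled by the letter through `ζ` (`exists_letter_stalkIdeal_eq`), distinct `ζ` by distinct letters (their primes at `x` differ).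
[cite: BierstoneGrigorievMilmanWlodarczyk2011, Def. 3.1.1] [cite: Kollar2007, (3.111) Step 3] -/
theorem hasSNC_divisorial_of_singleRow :
    HasSNC (boundaryOf ((finite_divisorialPoints (ne_bot_of_singleRow K hrow)).toFinset.toList.map
      fun ζ => (primeDivisorIdeal ζ, (idealOrder K ζ).toNat))) := by
  set S := (finite_divisorialPoints (ne_bot_of_singleRow K hrow)).toFinset with hSdef
  have hmemS : ∀ {ζ}, ζ ∈ S ↔ ζ ∈ divisorialPoints K := fun {ζ} => by rw [hSdef, Set.Finite.mem_toFinset]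
  -- membership in the boundary list
  have hbd : ∀ {D : X.IdealSheafData}, D ∈ boundaryOf (S.toList.map fun ζ => (primeDivisorIdeal ζ, (idealOrder K ζ).toNat)) →
      ∃ ζ ∈ divisorialPoints K, D = primeDivisorIdeal ζ := by
    intro D hD
    rw [boundaryOf, List.map_map, List.mem_map] at hD
    obtain ⟨ζ, hζ, rfl⟩ := hD
    exact ⟨ζ, hmemS.mp (Finset.mem_toList.mp hζ), rfl⟩
  refine hasSNC_of_isRsopPart_labels _ fun x => ?_
  by_cases hx : x ∈ (K.support : Set X)
  swap
  · -- off the cosupport no prime divisor passes: the empty labelling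
    haveI : IsRegularLocalRing (X.presheaf.stalk x) := hX x
    have hempty : ∀ D : {D : X.IdealSheafData //
        D ∈ boundaryOf (S.toList.map fun ζ => (primeDivisorIdeal ζ, (idealOrder K ζ).toNat)) ∧ x ∈ D.support}, False := by
      intro D
      obtain ⟨ζ, hζ, hD⟩ := hbd D.2.1
      have hsp : ζ ⤳ x := (mem_support_primeDivisorIdeal_iff ζ x).mp (hD ▸ D.2.2)
      exact hx (hsp.mem_closed K.support.isClosed hζ.1)
    exact ⟨0, Fin.elim0, isRsopPart_of_isRegularLocalRing_zero _,
      ⟨fun D => (hempty D).elim, fun D => (hempty D).elim, fun D => (hempty D).elim⟩⟩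
  -- at a point of the cosupport: a presentation
  obtain ⟨U, A, hxU, hsnc, hK⟩ := hrow x hx
  obtain ⟨hA₀, hK₀⟩ := presentation_comapExp K hsnc hK
  set x₀ : (U : Scheme.{u}) := ⟨x, hxU⟩ with hx₀
  obtain ⟨m, z₀, hz₀, ⟨ι₀, hι₀inj, hι₀⟩, -⟩ := hA₀.exists_isRsopPart_labels x₀
  let φ : X.presheaf.stalk x ≃+* (U : Scheme.{u}).presheaf.stalk x₀ := (asIso (U.ι.stalkMap x₀)).commRingCatIsoToRingEquiv
  -- for a prime divisor `cl ζ ∋ x`: the point `ζ₀` of `U` over `ζ` and the letter through it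
  have hdata : ∀ D : {D : X.IdealSheafData //
      D ∈ boundaryOf (S.toList.map fun ζ => (primeDivisorIdeal ζ, (idealOrder K ζ).toNat)) ∧ x ∈ D.support},
      ∃ (ζ₀ : (U : Scheme.{u})) (hζ₀ : ζ₀ ⤳ x₀) (p : ((U : Scheme.{u}).IdealSheafData × ℕ)), D.1 = primeDivisorIdeal (U.ι ζ₀) ∧
        p ∈ comapExp A U.ι ∧ x₀ ∈ p.1.support ∧ stalkIdeal p.1 x₀ = primeOfSpecializes hζ₀ := by
    intro D
    obtain ⟨ζ, hζ, hD⟩ := hbd D.2.1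
    have hsp : ζ ⤳ x := (mem_support_primeDivisorIdeal_iff ζ x).mp (hD ▸ D.2.2)
    have hζU : ζ ∈ (U : Set X) := hsp.mem_open U.2 hxU
    set ζ₀ : (U : Scheme.{u}) := ⟨ζ, hζU⟩ with hζ₀def
    have hsp₀ : ζ₀ ⤳ x₀ := (U.ι.isOpenEmbedding.isInducing.specializes_iff).mp hsp
    have hζ1 : Order.coheight ζ₀ = 1 := by rw [← hζ.2]; exact (coheight_eq_of_isOpenImmersion (f := U.ι) (x := ζ₀)).symm
    have hζsupp : ζ₀ ∈ (monomialIdeal (comapExp A U.ι)).support := by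
      rw [← hK₀]
      change ζ₀ ∈ ((K.comap U.ι).support : Set (U : Scheme.{u}))
      rw [Scheme.IdealSheafData.support_comap]
      exact hζ.1
    obtain ⟨p, hp, -, hxp, hst⟩ := exists_letter_stalkIdeal_eq (comapExp A U.ι) hA₀ hsp₀ hζ1 hζsupp
    exact ⟨ζ₀, hsp₀, p, hD, hp, hxp, by rw [hst, stalkIdeal_primeDivisorIdeal hsp₀]⟩
  choose ζ₀ hζ₀ p hDζ hp hxp hst using hdata
  refine ⟨m, fun i => φ.symm (z₀ i), hz₀.map_ringEquiv φ.symm,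
    fun D => ι₀ ⟨(p D).1, fst_mem_boundaryOf (hp D), hxp D⟩, ?_, fun D => ?_⟩
  · -- injectivity: equal labels ⇒ equal letters ⇒ equal primes `𝔭_{ζ₀}` ⇒ equal points ⇒ equal divisors
    intro D D' hDD'
    have h1 : (p D).1 = (p D').1 := congrArg (fun E : {D // D ∈ boundaryOf (comapExp A U.ι) ∧ x₀ ∈ D.support} => E.1) (hι₀inj hDD')
    have h2 : primeOfSpecializes (hζ₀ D) = primeOfSpecializes (hζ₀ D') := by rw [← hst D, ← hst D', h1]
    have h3 : ζ₀ D = ζ₀ D' := eq_of_primeOfSpecializes_eq (hζ₀ D) (hζ₀ D') h2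
    apply Subtype.ext
    rw [hDζ D, hDζ D', h3]
  · -- the stalk: `(𝓘_{cl ζ})_x = φ⁻¹ (letter stalk) = (φ⁻¹ z₀ (ι₀ letter))`
    have h1 : stalkIdeal D.1 x = (stalkIdeal (primeDivisorIdeal (ζ₀ D)) x₀).comap (φ : X.presheaf.stalk x →+* _) := by
      have h := stalkIdeal_eq_comap_stalkIdeal_comap U.ι (primeDivisorIdeal (U.ι (ζ₀ D))) x₀
      rw [comap_primeDivisorIdeal_of_isOpenImmersion] at h
      rw [hDζ D]
      exact h
    rw [h1, stalkIdeal_primeDivisorIdeal (hζ₀ D), ← hst D, hι₀ ⟨(p D).1, fst_mem_boundaryOf (hp D), hxp D⟩]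
    change Ideal.comap φ (Ideal.span {z₀ _}) = _
    rw [← Ideal.map_symm, Ideal.map_span, Set.image_singleton]

omit [IsIntegral X] [AlgebraicGeometry.IsNoetherian X] in
/-- Distinct points have distinct prime-divisor ideal sheaves (the closure of a point determines the point). [folklore] -/
theorem primeDivisorIdeal_injective : Function.Injective (primeDivisorIdeal : X → X.IdealSheafData) := by
  intro ζ ζ' h
  have key : ∀ {a b : X}, primeDivisorIdeal a = primeDivisorIdeal b → a ⤳ b := fun {a b} hab => by
    rw [← mem_support_primeDivisorIdeal_iff, hab, mem_support_primeDivisorIdeal_iff]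
  exact ((key h).antisymm (key h.symm)).eq

include hrow in
open scoped Classical in
/-- The divisorial boundary list has no duplicates. [folklore] -/
theorem nodup_boundaryOf_divisorial_of_singleRow :
    (boundaryOf ((finite_divisorialPoints (ne_bot_of_singleRow K hrow)).toFinset.toList.map
      fun ζ => (primeDivisorIdeal ζ, (idealOrder K ζ).toNat))).Nodup := by
  rw [boundaryOf, List.map_map]
  exact (Finset.nodup_toList _).map fun ζ ζ' h => primeDivisorIdeal_injective h

include hX hrow in
/-- **THE PACKAGE**: a locally single-row END ideal on a regular integral Noetherian scheme is a GLOBAL marked monomial ideal with snc,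
duplicate-free boundary — `K = monomialIdeal E` with `HasSNC (boundaryOf E)` (letters `𝓘_{cl ζ}`, exponents `ord_ζ K`, `ζ` the
codimension-one points of `cosupp K`). [cite: Kollar2007, (3.111) Step 3] [cite: CossartPiltant2008, proof of Prop. 4.2] -/
theorem exists_hasSNC_monomialIdeal_of_singleRow :
    ∃ E : List (X.IdealSheafData × ℕ), HasSNC (boundaryOf E) ∧ (boundaryOf E).Nodup ∧ K = monomialIdeal E := by
  classical
  exact ⟨_, hasSNC_divisorial_of_singleRow hX K hrow, nodup_boundaryOf_divisorial_of_singleRow K hrow,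
    eq_monomialIdeal_divisorial_of_singleRow hX K hrow⟩

include hX hrow in
/-- **THE MONOMIAL CASE OF (G-T), GLOBALLY**: for a locally single-row END ideal `K` on a regular integral Noetherian scheme and `m ≥ 1`,
Kollár's Step 3 gives a sequence of blowings up at snc strata inside the successive marked supports resolving `(K, m)` on all of `X` at once
(no patching of presentations). [cite: Kollar2007, (3.111) Step 3] [cite: BierstoneGrigorievMilmanWlodarczyk2011, §4 Step 2b] -/
theorem exists_isResolutionOf_of_singleRow {m : ℕ} (hm : 1 ≤ m) :
    ∃ (E : List (X.IdealSheafData × ℕ)) (s : CentreSeq X), HasSNC (boundaryOf E) ∧ K = monomialIdeal E ∧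
      s.IsResolutionOf (monomialMarked E m) := by
  obtain ⟨E, hE, -, hK⟩ := exists_hasSNC_monomialIdeal_of_singleRow hX K hrow
  obtain ⟨s, hs⟩ := exists_isResolutionOf_monomialMarked E hE hm
  exact ⟨E, s, hE, hK, hs⟩

include hX hrow in
/-- **(G-T) MONOMIAL CASE, IN THE X3 CURRENCY OF RECORD**: for a locally single-row END ideal `K` on a regular integral Noetherian scheme and
`m ≥ 1`, the conclusion of `X3LemmaM.EndOrderReduction m` holds for `K` — a `CentreSeq` with regular centres over `Sing(K, m)`, regular top,
`K·𝒪 = M·K₁` with `M` effective Cartier, `ord K₁ < m` everywhere, `K₁` locally END, `cosupp K₁` over `cosupp K` (res-D-pv-046's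
`endOrderReduction_of_presentation` on the GLOBAL presentation of `exists_hasSNC_monomialIdeal_of_singleRow`).
[cite: Kollar2007, (3.111) Step 3] [cite: BierstoneGrigorievMilmanWlodarczyk2011, Def. 3.1.3, §4 Step 2b] -/
theorem endOrderReduction_of_singleRow {m : ℕ} (hm : 1 ≤ m) :
    ∃ s : CentreSeq X, s.AllRegular ∧ s.CentresOver (singGE K m) ∧ Scheme.IsRegular s.top ∧
      ∃ (_ : IsNoetherian s.top) (M K₁ : s.top.IdealSheafData) (𝓛₁ : List s.top.IdealSheafData),
        K.comap s.comp = M * K₁ ∧ IsEffectiveCartier M ∧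
        (∀ x : s.top, idealOrder K₁ x < (m : ℕ∞)) ∧
        (∀ x ∈ (K₁.support : Set s.top), IsEndNear K₁ 𝓛₁ x) ∧
        (K₁.support : Set s.top) ⊆ s.comp ⁻¹' (K.support : Set X) := by
  obtain ⟨E, hE, hnd, hK⟩ := exists_hasSNC_monomialIdeal_of_singleRow hX K hrow
  refine endOrderReduction_of_presentation (boundaryOf E) hE (MonomialCleanup.PointedDistinct.of_nodup hnd) [E]
    (fun A hA => by rw [List.mem_singleton.mp hA]) (List.cons_ne_nil _ _) ?_ hm
  rw [hK, DepthTargets.monomialSum_cons, DepthTargets.monomialSum_nil, sup_bot_eq]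

end SingleRow

end X3LemmaM

end Summit.ResolutionOfSingularities.ResolutionOfSingularities.Theorems

end
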